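import Mathlib
import Literature.Analysis.ODE.HighOrderEnclosureIntervalTest
import Literature.Analysis.ODE.SmoothFieldTaylorCoefficients
import HarnessLib

/-!
# The interval HOE existence test for a smooth (non-polynomial) field

`Literature.Analysis.ODE.highOrderEnclosure_step_intervalTest`
(`HighOrderEnclosureIntervalTest.lean`) states the high-order enclosure (HOE) existence test of
validated ODE integration — the single containment of interval vectors
`∑_{j<K} T^j · E_j + T^K · V ⊆ S` (Moore 1979 §8.1 (8.10), (8.13); Nedialkov–Jackson–Pryce 2001
§3; Nedialkov–Jackson–Corliss 1999 §5 Algorithm I) — for *polynomial* right-hand sides, where the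
Taylor coefficient maps are polynomial maps.  The sources state the test for a general smooth
autonomous field `y' = f(y)`, the coefficient maps `Φ_j = f^[j] = (1/j!) L_f^j Id` being generated
by automatic differentiation.  With the analytic dictionary of
`Literature.Analysis.ODE.SmoothFieldTaylorCoefficients` (`smoothTaylorMap hf j = Φ_j`, and
`highOrderEnclosure_step_smoothOn` / `highOrderEnclosure_step_smooth` discharging every analytic
hypothesis of `highOrderEnclosure_step`) the test becomes a statement about **box data only** for
smooth fields as well:

* `highOrderEnclosure_step_intervalTest_smoothOn` — `f` smooth on an open `Ω` containing the
  a-priori box `S`; sound enclosures `E_j ⊇ Φ_j(W)` (`j < K`), `V ⊇ Φ_K(S)` obtained by any sound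
  means (interval automatic differentiation, exact or outward rounded) and the containment
  `∑_{j<K} T^j · E_j + T^K · V ⊆ S` give existence on `[0, h]` and the enclosure of every solution
  from `W` in `S` and in the Taylor tube; the growth hypothesis `hloc` of the Picard–Lindelöf step
  is kept;
* `highOrderEnclosure_step_intervalTest_smooth` — `f` smooth on all of `ℝ^ι`: box data only;
* `highOrderEnclosure_tube_smooth`, `highOrderEnclosure_endpoint_smooth` — Moore's (8.10): every
  solution lies in the interval Taylor polynomial `∑_{j<K} T^j · E_j + T^K · V` over the step and
  in `∑_{j<K} [h,h]^j · E_j + [h,h]^K · V` at its end (the input of Lohner's / NJC's Algorithm II).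
-/

noncomputable section

open Set Metric NonemptyInterval TopologicalSpace

open scoped NNReal ContDiff

namespace Literature.Analysis.ODE

section Boxes

variable {ι : Type*}

/-- Boxes are compact (the hypothesis `hS` of `highOrderEnclosure_step_smoothOn`).
[cite: Moore1979, §2.1] -/
theorem isCompact_boxSet (B : ι → NonemptyInterval ℝ) : IsCompact (boxSet B) :=
  isCompact_Icc

end Boxes

section Smooth

variable {ι : Type*} [Fintype ι] {Ω : Opens (ι → ℝ)} {f : (ι → ℝ) → ι → ℝ}

/-- **High-order enclosure step for a field smooth on an open set, interval form.**  Let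
`y' = f(y)` with `f ∈ C^∞(Ω; ℝ^ι)`, `K ≥ 1`, `h ≥ 0`, a step interval `T ⊇ [0, h]`, an initial box
`W`, an a-priori box `S ⊆ Ω`, boxes `E_j ⊇ Φ_j(W)` (`j < K`) and `V ⊇ Φ_K(S)` enclosing the Taylor
coefficient maps `Φ_j = smoothTaylorMap hf j = (1/j!) L_f^j Id` (by *any* sound means), and
suppose the **HOE test** `∑_{j<K} T^j · E_j + T^K · V ⊆ S` holds as a containment of interval
vectors.  If `f` is Lipschitz on bounded sets (`hloc`), every `y₀ ∈ W` has a solution on `[0, h]`,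
and every solution `z` from `y₀` satisfies `z(t) ∈ S` and `z(t) ∈ ∑_{j<K} t^j Φ_j(y₀) + t^K · V`
for all `t ∈ [0, h]` (Moore 1979 §8.1 (8.10), (8.13); Nedialkov–Jackson–Pryce 2001 §3;
structural hypotheses of `highOrderEnclosure_step` discharged by
`highOrderEnclosure_step_smoothOn`, compactness and convexity of `S` by its box shape).
[cite: NedialkovJacksonPryce2001, §3 (HOE existence test)]
[cite: Moore1979, §8.1 eqs. (8.10), (8.13)] [cite: NedialkovJacksonCorliss1999, §5 Algorithm I] -/
theorem highOrderEnclosure_step_intervalTest_smoothOn (hf : ContDiffOn ℝ ∞ f (Ω : Set (ι → ℝ)))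
    {K : ℕ} (hK : 0 < K) {h : ℝ} (hh : 0 ≤ h) {T : NonemptyInterval ℝ}
    (hT : ∀ t ∈ Icc 0 h, t ∈ T) (W S V : ι → NonemptyInterval ℝ)
    (E : ℕ → ι → NonemptyInterval ℝ) (hSΩ : boxSet S ⊆ Ω)
    (hE : ∀ j < K, MapsTo (smoothTaylorMap hf j) (boxSet W) (boxSet (E j)))
    (hV : MapsTo (smoothTaylorMap hf K) (boxSet S) (boxSet V)) (htest : hoeBox T E V K ≤ S)
    (hloc : ∀ ρ : ℝ, ∃ K' : ℝ≥0, LipschitzOnWith K' f (closedBall 0 ρ))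
    {y₀ : ι → ℝ} (hy₀ : y₀ ∈ boxSet W) :
    (∃ y : ℝ → ι → ℝ, y 0 = y₀ ∧
        ∀ t ∈ Icc 0 h, HasDerivWithinAt y (f (y t)) (Icc 0 h) t) ∧
      ∀ z : ℝ → ι → ℝ, z 0 = y₀ →
        (∀ t ∈ Icc 0 h, HasDerivWithinAt z (f (z t)) (Icc 0 h) t) →
          ∀ t ∈ Icc 0 h, z t ∈ boxSet S ∧ ∃ v ∈ boxSet V,
            z t = (∑ j ∈ Finset.range K, t ^ j • smoothTaylorMap hf j y₀) + t ^ K • v :=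
  highOrderEnclosure_step_smoothOn hf hK hSΩ (isCompact_boxSet S) (convex_boxSet S)
    (boxLo_le_boxHi V) hV hh hloc (hincl_of_hoeBox hT hE htest) hy₀

/-- **High-order enclosure step for a globally smooth field, interval form: box data only.**
For `f ∈ C^∞(ℝ^ι; ℝ^ι)`, `K ≥ 1`, `h ≥ 0`, `T ⊇ [0, h]`, boxes `W`, `S`, sound enclosures
`E_j ⊇ Φ_j(W)` (`j < K`), `V ⊇ Φ_K(S)` of the Taylor coefficient maps `Φ_j = (1/j!) L_f^j Id`, the
HOE test `∑_{j<K} T^j · E_j + T^K · V ⊆ S` alone yields existence on `[0, h]` and the enclosure of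
every solution from `W` in `S` and in `∑_{j<K} t^j Φ_j(y₀) + t^K · V` — all analytic and growth
hypotheses of `highOrderEnclosure_step` discharged by `highOrderEnclosure_step_smooth`.
[cite: NedialkovJacksonPryce2001, §3 (HOE existence test)]
[cite: Moore1979, §8.1 eqs. (8.10), (8.13)] [cite: NedialkovJacksonCorliss1999, §5 Algorithm I] -/
theorem highOrderEnclosure_step_intervalTest_smooth (hf : ContDiff ℝ ∞ f) {K : ℕ} (hK : 0 < K)
    {h : ℝ} (hh : 0 ≤ h) {T : NonemptyInterval ℝ} (hT : ∀ t ∈ Icc 0 h, t ∈ T)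
    (W S V : ι → NonemptyInterval ℝ) (E : ℕ → ι → NonemptyInterval ℝ)
    (hE : ∀ j < K, MapsTo (smoothTaylorMap (Ω := ⊤) hf.contDiffOn j) (boxSet W) (boxSet (E j)))
    (hV : MapsTo (smoothTaylorMap (Ω := ⊤) hf.contDiffOn K) (boxSet S) (boxSet V))
    (htest : hoeBox T E V K ≤ S) {y₀ : ι → ℝ} (hy₀ : y₀ ∈ boxSet W) :
    (∃ y : ℝ → ι → ℝ, y 0 = y₀ ∧
        ∀ t ∈ Icc 0 h, HasDerivWithinAt y (f (y t)) (Icc 0 h) t) ∧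
      ∀ z : ℝ → ι → ℝ, z 0 = y₀ →
        (∀ t ∈ Icc 0 h, HasDerivWithinAt z (f (z t)) (Icc 0 h) t) →
          ∀ t ∈ Icc 0 h, z t ∈ boxSet S ∧ ∃ v ∈ boxSet V,
            z t = (∑ j ∈ Finset.range K, t ^ j • smoothTaylorMap (Ω := ⊤) hf.contDiffOn j y₀)
              + t ^ K • v :=
  highOrderEnclosure_step_smooth hf hK (isBounded_boxSet S) (convex_boxSet S) (boxLo_le_boxHi V)
    hV hh (hincl_of_hoeBox hT hE htest) hy₀

/-- **The Taylor tube over the step** (Moore 1979 (8.10)): under the hypotheses of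
`highOrderEnclosure_step_intervalTest_smooth`, every solution `z` from `y₀ ∈ W` satisfies
`z(t) ∈ ∑_{j<K} T^j · E_j + T^K · V` for all `t ∈ [0, h]` — the interval vector the HOE test
compares with `S` is itself an enclosure of the solution over the whole step.
[cite: Moore1979, §8.1 eq. (8.10)] [cite: NedialkovJacksonPryce2001, §3 (HOE existence test)] -/
theorem highOrderEnclosure_tube_smooth (hf : ContDiff ℝ ∞ f) {K : ℕ} (hK : 0 < K)
    {h : ℝ} (hh : 0 ≤ h) {T : NonemptyInterval ℝ} (hT : ∀ t ∈ Icc 0 h, t ∈ T)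
    (W S V : ι → NonemptyInterval ℝ) (E : ℕ → ι → NonemptyInterval ℝ)
    (hE : ∀ j < K, MapsTo (smoothTaylorMap (Ω := ⊤) hf.contDiffOn j) (boxSet W) (boxSet (E j)))
    (hV : MapsTo (smoothTaylorMap (Ω := ⊤) hf.contDiffOn K) (boxSet S) (boxSet V))
    (htest : hoeBox T E V K ≤ S) {y₀ : ι → ℝ} (hy₀ : y₀ ∈ boxSet W) {z : ℝ → ι → ℝ}
    (hz0 : z 0 = y₀) (hz : ∀ t ∈ Icc 0 h, HasDerivWithinAt z (f (z t)) (Icc 0 h) t)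
    {t : ℝ} (ht : t ∈ Icc 0 h) : z t ∈ boxSet (hoeBox T E V K) := by
  obtain ⟨-, huniq⟩ :=
    highOrderEnclosure_step_intervalTest_smooth hf hK hh hT W S V E hE hV htest hy₀
  obtain ⟨-, v, hv, hzv⟩ := huniq z hz0 hz t ht
  rw [hzv]
  exact taylorSum_mem_hoeBox (hT t ht) (fun j hj => hE j hj hy₀) hv

/-- **The tight enclosure at the end of the step** (Moore 1979 (8.10) at `t = t₁`; the starting
point of Lohner's / NJC's Algorithm II): under the hypotheses of
`highOrderEnclosure_step_intervalTest_smooth`, every solution `z` from `y₀ ∈ W` satisfies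
`z(h) ∈ ∑_{j<K} [h, h]^j · E_j + [h, h]^K · V`. [cite: Moore1979, §8.1 eq. (8.10)]
[cite: NedialkovJacksonCorliss1999, §5 Algorithm I] -/
theorem highOrderEnclosure_endpoint_smooth (hf : ContDiff ℝ ∞ f) {K : ℕ} (hK : 0 < K)
    {h : ℝ} (hh : 0 ≤ h) {T : NonemptyInterval ℝ} (hT : ∀ t ∈ Icc 0 h, t ∈ T)
    (W S V : ι → NonemptyInterval ℝ) (E : ℕ → ι → NonemptyInterval ℝ)
    (hE : ∀ j < K, MapsTo (smoothTaylorMap (Ω := ⊤) hf.contDiffOn j) (boxSet W) (boxSet (E j)))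
    (hV : MapsTo (smoothTaylorMap (Ω := ⊤) hf.contDiffOn K) (boxSet S) (boxSet V))
    (htest : hoeBox T E V K ≤ S) {y₀ : ι → ℝ} (hy₀ : y₀ ∈ boxSet W) {z : ℝ → ι → ℝ}
    (hz0 : z 0 = y₀) (hz : ∀ t ∈ Icc 0 h, HasDerivWithinAt z (f (z t)) (Icc 0 h) t) :
    z h ∈ boxSet (hoeBox (NonemptyInterval.pure h) E V K) := by
  obtain ⟨-, huniq⟩ :=
    highOrderEnclosure_step_intervalTest_smooth hf hK hh hT W S V E hE hV htest hy₀
  obtain ⟨-, v, hv, hzv⟩ := huniq z hz0 hz h ⟨hh, le_rfl⟩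
  rw [hzv]
  exact taylorSum_mem_hoeBox (mem_pure_self h) (fun j hj => hE j hj hy₀) hv

/-- **The Taylor tube, open-set version**: under the hypotheses of
`highOrderEnclosure_step_intervalTest_smoothOn`, every solution from `y₀ ∈ W` lies in
`∑_{j<K} T^j · E_j + T^K · V` over the whole step. [cite: Moore1979, §8.1 eq. (8.10)]
[cite: NedialkovJacksonPryce2001, §3 (HOE existence test)] -/
theorem highOrderEnclosure_tube_smoothOn (hf : ContDiffOn ℝ ∞ f (Ω : Set (ι → ℝ)))
    {K : ℕ} (hK : 0 < K) {h : ℝ} (hh : 0 ≤ h) {T : NonemptyInterval ℝ}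
    (hT : ∀ t ∈ Icc 0 h, t ∈ T) (W S V : ι → NonemptyInterval ℝ)
    (E : ℕ → ι → NonemptyInterval ℝ) (hSΩ : boxSet S ⊆ Ω)
    (hE : ∀ j < K, MapsTo (smoothTaylorMap hf j) (boxSet W) (boxSet (E j)))
    (hV : MapsTo (smoothTaylorMap hf K) (boxSet S) (boxSet V)) (htest : hoeBox T E V K ≤ S)
    (hloc : ∀ ρ : ℝ, ∃ K' : ℝ≥0, LipschitzOnWith K' f (closedBall 0 ρ))
    {y₀ : ι → ℝ} (hy₀ : y₀ ∈ boxSet W) {z : ℝ → ι → ℝ} (hz0 : z 0 = y₀)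
    (hz : ∀ t ∈ Icc 0 h, HasDerivWithinAt z (f (z t)) (Icc 0 h) t) {t : ℝ} (ht : t ∈ Icc 0 h) :
    z t ∈ boxSet (hoeBox T E V K) := by
  obtain ⟨-, huniq⟩ :=
    highOrderEnclosure_step_intervalTest_smoothOn hf hK hh hT W S V E hSΩ hE hV htest hloc hy₀
  obtain ⟨-, v, hv, hzv⟩ := huniq z hz0 hz t ht
  rw [hzv]
  exact taylorSum_mem_hoeBox (hT t ht) (fun j hj => hE j hj hy₀) hv

end Smooth

end Literature.Analysis.ODE
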